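import Literature.Probability.LatticeModels.DiluteLoopModelSAW
import Literature.Probability.RandomPlanarGeometry.SelfAvoidingWalk
import HarnessLib

/-!
# The `n = w = 0` two-leg partition function at `x_c` is the mass of the critical SAW measure

Topic `Literature/Probability/LatticeModels`; last link of sanity identity (ii) of the definition
item `defn-DiluteLoopModel` (route `CriticalPhenomena/SAWScalingLimit/SAWLoopFugacityFlow`): on a
discretised domain `Ω_δ`, for a vertex `a` of `Ω_δ` and `b ≠ a`, the self-avoiding walks
`SAW.DomainSAW Ω δ a b` of `RandomPlanarGeometry/SelfAvoidingWalk.lean` are in bijection with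
`DiluteLoopModel.pathsIn (discreteDomainGraph Ω δ) (meshDomainFinset Ω δ) a b`, so the total mass
of the critical SAW measure `SAW.weight Ω δ a b` (`γ ↦ x_c^{|γ|}`, `x_c = μ⁻¹ =
SAW.criticalFugacity`) is `Z_{0,0,x_c}(Ω_δ; {a} ∆ {b})`
(`SAW.weight_univ_eq_domainPartitionFunction`); its normalisation `SAW.law Ω δ a b` is the
probability measure whose avoidance probabilities the route's item AvoidanceLimit is about.

## References

* H. Duminil-Copin, S. Smirnov, Ann. of Math. 175 (2012), §4 (the measure `P_{x,δ}`).
  [DuminilCopinSmirnov2012]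
* N. Madras, G. Slade, *The Self-Avoiding Walk* (1993), §1.2–1.3. [MadrasSlade1993]
-/

noncomputable section

open Finset MeasureTheory
open scoped symmDiff ENNReal

namespace Literature.Probability.LatticeModels.DiluteLoopModel

open Literature.Probability.RandomPlanarGeometry

variable {Ω : Set ℂ} {δ : ℝ} {a b : Site 2}

/-- The self-avoiding walks of `Ω_δ` from a vertex `a` of `Ω_δ` to `b`, as elements of `pathsIn`:
the map `γ ↦ γ.walk` is a bijection onto `pathsIn (discreteDomainGraph Ω δ) (meshDomainFinset Ω δ) a b`.
[cite: DuminilCopinSmirnov2012, §4 (before Conjecture 1)] -/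
def domainSAWFinset (ha : a ∈ meshDomainFinset Ω δ) : Finset (SAW.DomainSAW Ω δ a b) :=
  (pathsIn (discreteDomainGraph Ω δ) (meshDomainFinset Ω δ) a b).attach.map
    ⟨fun p => ⟨p.1, ((mem_pathsIn_discreteDomainGraph ha).1 p.2)⟩, fun p q h => by
      apply Subtype.ext
      have := congrArg SAW.DomainSAW.walk h
      exact this⟩

/-- Every self-avoiding walk of `Ω_δ` from a vertex of `Ω_δ` belongs to `domainSAWFinset` (so the
type `SAW.DomainSAW Ω δ a b` is finite). [cite: DuminilCopinSmirnov2012, §4 (before Conjecture 1)] -/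
theorem mem_domainSAWFinset (ha : a ∈ meshDomainFinset Ω δ) (γ : SAW.DomainSAW Ω δ a b) :
    γ ∈ domainSAWFinset ha := by
  rw [domainSAWFinset, mem_map]
  refine ⟨⟨γ.walk, (mem_pathsIn_discreteDomainGraph ha).2 γ.isPath⟩, mem_attach _ _, ?_⟩
  rfl

/-- **The total mass of the critical SAW measure is the `n = w = 0` two-leg partition function at
`x_c`:** `SAW.weight Ω δ a b univ = Z_{0,0,x_c}(Ω_δ; {a} ∆ {b})` for a vertex `a` of `Ω_δ` and
`b ≠ a`. [cite: DuminilCopinSmirnov2012, §4 (before Conjecture 1)] -/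
theorem SAW.weight_univ_eq_domainPartitionFunction (ha : a ∈ meshDomainFinset Ω δ) (hab : a ≠ b) :
    SAW.weight Ω δ a b Set.univ = ENNReal.ofReal
      ((⟨0, 0, SAW.criticalFugacity⟩ : DiluteLoopModel ℝ).domainPartitionFunction Ω δ ({a} ∆ {b})) := by
  classical
  have hx : 0 ≤ SAW.criticalFugacity :=
    inv_nonneg.2 (Real.iInf_nonneg fun n => Real.rpow_nonneg (Nat.cast_nonneg _) _)
  rw [SAW.weight, Measure.sum_apply _ MeasurableSpace.measurableSet_top]
  simp only [Measure.smul_apply, Measure.dirac_apply_of_mem (Set.mem_univ _), smul_eq_mul, mul_one]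
  rw [tsum_eq_sum (s := domainSAWFinset ha) (fun γ hγ => absurd (mem_domainSAWFinset ha γ) hγ),
    domainPartitionFunction_zero_zero_eq_sum_paths _ hab, domainSAWFinset, sum_map,
    ENNReal.ofReal_sum_of_nonneg fun p _ => pow_nonneg hx _]
  exact sum_attach (pathsIn (discreteDomainGraph Ω δ) (meshDomainFinset Ω δ) a b)
    fun p => ENNReal.ofReal (SAW.criticalFugacity ^ p.length)

end Literature.Probability.LatticeModels.DiluteLoopModel
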